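import Literature.Probability.LatticeModels.VillainSpinWaveDuality
import HarnessLib

/-!
# Active and shell edges of the cube with grounded boundary: the zero-boundary-condition Villain
# weight is `v_β(0)^{#shell edges}` times the weight of the active edges

Groundwork (vortex-gas programme, clause (iv)) for the named fact
`Literature.Probability.LatticeModels.FrohlichSpencerVillainSpinWaveBound` (`VillainSpinWave.lean`).
The printed Gibbs weight `dirichletVillainWeight β n` (Dario–Wu (1.1)) is a product over ALL edges of
the cube `□ = box d (n+1)`, including the SHELL EDGES joining two grounded vertices (both
end-points off the interior `box d n`), on which the gradient `dθ̄` vanishes identically: they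
contribute the constant `v_β(0)` each. For the vortex-gas analysis these edges are discarded
(`VillainVorticity.lean`: the classes of the duality sum carry an independent integer on each shell
edge, decoupled from the observable). This file makes the split:

* `activeEdges d n` (at least one interior end-point), `shellEdges d n`, the partition
  `cubeEdges = activeEdges ∪ shellEdges` (`filter`/`filter not`);
* `gradR_apply_eq_zero_of_shell` — `(dθ̄)_e = 0` on shell edges;
* **`dirichletVillainWeight_eq_pow_mul_prod_active`** —
  `w_β(θ) = v_β(0)^{#shellEdges} · ∏_{e active} v_β((dθ̄)_e)`.

Everything is proved; `activeEdges`, `shellEdges` are data (Finsets); no named fact is introduced.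

## References

* [DarioWu2020] P. Dario, W. Wu, arXiv:2002.02946, Ch. 1 §1 eq. (1.1) (PDF p. 4).
* [FrohlichSpencerCMP1982] J. Fröhlich, T. Spencer, Comm. Math. Phys. 83 (1982) 411–454, §2.4.
-/

noncomputable section

open Finset Function

namespace Literature.Probability.LatticeModels

namespace DirichletVillain

open Literature.MathematicalPhysics.QuantumFieldTheory

variable {d : ℕ} {n : ℕ}

variable (d n) in
/-- The **active edges** of the cube `box d (n+1)`: those with at least one end-point in the
interior `box d n` (a free angle). [folklore] -/
def activeEdges : Finset (Site d × Fin d) :=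
  (cubeEdges d n).filter fun p => p.1 ∈ box d n ∨ p.1 + Pi.single p.2 1 ∈ box d n

variable (d n) in
/-- The **shell edges** of the cube: both end-points on the grounded shell `box d (n+1) ∖ box d n`.
[folklore] -/
def shellEdges : Finset (Site d × Fin d) :=
  (cubeEdges d n).filter fun p => ¬(p.1 ∈ box d n ∨ p.1 + Pi.single p.2 1 ∈ box d n)

/-- Membership in `activeEdges`. [folklore] -/
theorem mem_activeEdges {p : Site d × Fin d} :
    p ∈ activeEdges d n ↔ p ∈ cubeEdges d n ∧ (p.1 ∈ box d n ∨ p.1 + Pi.single p.2 1 ∈ box d n) :=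
  Finset.mem_filter

/-- Membership in `shellEdges`. [folklore] -/
theorem mem_shellEdges {p : Site d × Fin d} :
    p ∈ shellEdges d n ↔ p ∈ cubeEdges d n ∧ p.1 ∉ box d n ∧ p.1 + Pi.single p.2 1 ∉ box d n := by
  rw [shellEdges, Finset.mem_filter, not_or]

/-- **The gradient vanishes on shell edges**: both end-points are grounded. [folklore] -/
theorem gradR_apply_eq_zero_of_shell (θ : SIdx d n → ℝ) (e : EIdx d n) (h1 : e.1.1 ∉ box d n)
    (h2 : e.1.1 + Pi.single e.1.2 1 ∉ box d n) : gradR n θ e = 0 := by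
  rw [gradR_apply, dirichletExtend_of_not_mem _ h2, dirichletExtend_of_not_mem _ h1, sub_zero]

/-- **The zero-boundary-condition Villain weight splits off the shell edges**:
`w_β(θ) = v_β(0)^{#shellEdges} · ∏_{(x,i) active} v_β(θ̄(x + eᵢ) − θ̄(x))`.
[cite: DarioWu2020, Ch. 1 §1 eq. (1.1) (PDF p. 4)] -/
theorem dirichletVillainWeight_eq_pow_mul_prod_active (β : ℝ) (θ : SIdx d n → ℝ) :
    dirichletVillainWeight β n θ =
      villainKernel β 0 ^ #(shellEdges d n) *
        ∏ p ∈ activeEdges d n,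
          villainKernel β (dirichletExtend n θ (p.1 + Pi.single p.2 1) - dirichletExtend n θ p.1) := by
  set f : Site d × Fin d → ℝ := fun p =>
    villainKernel β (dirichletExtend n θ (p.1 + Pi.single p.2 1) - dirichletExtend n θ p.1) with hf
  have h1 : dirichletVillainWeight β n θ = ∏ p ∈ cubeEdges d n, f p := by
    rw [dirichletVillainWeight_eq_prod, ← Finset.prod_coe_sort (cubeEdges d n) f]
    refine Finset.prod_congr rfl fun e _ => ?_
    rw [gradR_apply]
  rw [h1, ← Finset.prod_filter_mul_prod_filter_not (cubeEdges d n)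
    (fun p : Site d × Fin d => p.1 ∈ box d n ∨ p.1 + Pi.single p.2 1 ∈ box d n) f, mul_comm]
  congr 1
  -- the shell edges contribute `v_β(0)` each
  rw [show (cubeEdges d n).filter (fun p : Site d × Fin d =>
      ¬(p.1 ∈ box d n ∨ p.1 + Pi.single p.2 1 ∈ box d n)) = shellEdges d n from rfl]
  refine (Finset.prod_congr rfl fun p hp => ?_).trans (Finset.prod_const _)
  obtain ⟨-, hp1, hp2⟩ := mem_shellEdges.1 hp
  simp only [hf, dirichletExtend_of_not_mem _ hp1, dirichletExtend_of_not_mem _ hp2, sub_zero]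

end DirichletVillain

end Literature.Probability.LatticeModels
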